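import Summits.Ventures.PercRepro.S1FixedFrame
import Summits.Ventures.PercRepro.S1LevelFourB

/-!
# PercRepro — S1 LEVEL FOUR, PHASE 3: C-025 at level `4` for every finite matroid and every `p ≥ 25` (p2, gen 15)

`proofs/SUBCLAIM-S1-p2.md` §2 (L-GAP-0) and §6: the `e`-free core of rank `25` is closed at every corank
(`S1Tail25.c025_core_four_twentyfive`), so the FIXED-rank frame `S1.rls_succ_fixed 3 4 25` (`S1FixedFrame`) gives
level `4` at `p = 25` from the `q = 3` row at `p = 24` (`SevenThree.c025_three_all`) and Theorem M at corank `≤ 4`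
(`RLS_of_ncard_lt` / `RLS_of_ncard_eq`) — the rank `rls_succ_large 3 4 25` cannot reach (it yields `p ≥ 26`).

* **`c025_four_twentyfive`** — `ThmN.RLS M 25 4` for every finite matroid `M`;
* **`c025_four_from_twentyfive`** — `ThmN.RLS M p 4` for every `p ≥ 25` (with `S1LevelFourB.c025_four_twentysix`);
* `c025_four_from_twentyfive'` — the same in the literal vocabulary of `C025`.
Axioms: standard.
-/

open scoped Matroid

namespace PercRepro

namespace S1

variable {α : Type}

/-- **Level `4` at rank `25`**: every finite matroid satisfies `Φ(25, 4)·#U(25, 4) ≤ #Y(25, 4)`. -/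
theorem c025_four_twentyfive (M : Matroid α) [M.Finite] : ThmN.RLS M 25 4 := by
  refine rls_succ_fixed (α := α) 3 4 25 (by omega) ?_ ?_ ?_ M
  · -- level `3` at rank `24` (the `q = 3` row)
    intro M' _
    exact SevenThree.c025_three_all M' 24 (by omega)
  · -- corank `≤ 4`: `U = ∅` or Theorem M
    intro M' _ hn
    rcases Nat.lt_or_ge M'.E.ncard (25 + 4) with h | h
    · exact ThmN.RLS_of_ncard_lt M' h
    · exact ThmN.RLS_of_ncard_eq M' (by omega)
  · -- the core of rank `25` at every corank `≥ 5`
    intro M' _ hR hbig hfree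
    exact c025_core_four_twentyfive M' hR hbig hfree

/-- **THE END THEOREM OF PHASE 3**: every finite matroid satisfies C-025 at level `4` for every `p ≥ 25`. -/
theorem c025_four_from_twentyfive (M : Matroid α) [M.Finite] (p : ℕ) (hp : 25 ≤ p) : ThmN.RLS M p 4 := by
  rcases Nat.lt_or_ge p 26 with h | h
  · have hp25 : p = 25 := by omega
    subst hp25
    exact c025_four_twentyfive M
  · exact c025_four_twentysix M p h

/-- The phase-3 theorem in the literal vocabulary of `C025` (the body at `(p, 4)`). -/
theorem c025_four_from_twentyfive' (M : Matroid α) [M.Finite] (p : ℕ) (hp : 25 ≤ p) :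
    phiK p 4 * ({A : Set α | A ⊆ M.E ∧ M.eRk A = (p : ℕ∞) ∧ M.eRk (M.E \ A) = (4 : ℕ∞)}.ncard : ℚ) ≤
      ({A : Set α | A ⊆ M.E ∧ (4 : ℕ∞) < M.eRk A ∧ M.eRk A < (p : ℕ∞)}.ncard : ℚ) :=
  c025_four_from_twentyfive M p hp

end S1

end PercRepro
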